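import Summits.BirchSwinnertonDyer.Rank1Residual.O5.HeegnerIndexThree
import Literature.NumberTheory.EllipticCurves.Jetchev2008.HeegnerIndexTamagawaBound
import HarnessLib
import HarnessLib.Audit.Tags

/-!
# S-O5-1 — Jetchev's Tamagawa-sharpened Kolyvagin bound at an additive prime (support CONJECTURE; EVIDENCE-labelled)

Cell `b2b-bsdres`, team O5 (planner o5-r2, GEN 2). HONEST FRAMING: research route; nothing below is in print as
stated; census output = EVIDENCE / conjecture items, never a Literature fact.

D. Jetchev, Compos. Math. 144 (2008), Cor. 1.5 (tree fact
`Literature.NumberTheory.EllipticCurves.Jetchev2008.cor15_padicValNat_card_primaryComponent_sha_le`) is printed under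
Hypothesis (∗) "`p ∤ N` and `ρ̄_{E,p}` surjective". Page reads (o5-r2 GEN 2, NOTES.md `## HANDOFF`): the only textual use
of `p ∤ N` is Remark 1.2 (Abbes–Ullmo ⇒ `p ∤ c_Manin`, not part of Cor. 1.5) [Jetchev2008, p. 3]; the reduction input
Prop. 3.1 / Cor. 3.2 is Gross–Zagier's statement at places `v ∣ N` [p. 8]; Lemmas 4.3, 4.5 and Prop. 4.2 are `v ∤ p`
statements [p. 9]; the proof of Thm. 6.3 modifies the Selmer structure only at the two places over the prime `q`
realising `m_max = max ord_p c_q` [pp. 15–16] — and `q ≠ p` as soon as `p ∤ c_v` for `v ∣ p`, which is automatic on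
the census cell O5 at `p = 3` (Kodaira III, III\*, I₀\*: `c_3 ∈ {1, 2, 4}`). Kolyvagin's machinery behind formula (1)
(Gross 1991 Prop. 2.1 / 6.2, McCallum 1991 Thm. 5.4) carries no `p ∤ N` [GrossLMS1991, pp. 214–231;
McCallumLMS1991, pp. 277–291]. Hence the conjecture below: Cor. 1.5 in the tree's monotone form with the binder
`p ∤ N` DROPPED and the Tamagawa prime restricted to `q ≠ p`. It is the load-bearing input of the per-pair closure of
the single-Tamagawa-3-prime rows of the O5 census cell (cells/o5o6/TARGETS.md §O5, o5-r2 GEN 2 addendum, shape (J)).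
Kill test: any certified Heegner pair (E, K) at `p = 3`, `9 ∣ N`, with certified index `k = ord₃[E(K):ℤy_K]` and a
prime `q ≠ 3`, `q ∣ N`, `ord₃ c_q > k` refutes it (engine KOLY-SQ3 / koly3 measures `k`; e.g. the measured `k = 2`
on the `3 ∣ c_q` row 17127b1 is consistent).
-/

noncomputable section

open scoped Classical

open WeierstrassCurve Literature.NumberTheory.EllipticCurves
  Literature.NumberTheory.EllipticCurves.ModularForms
  Literature.NumberTheory.EllipticCurves.Rank1Residual
  Literature.NumberTheory.EllipticCurves.Rank1Residual.Typed

namespace Summit.BirchSwinnertonDyer.Rank1Residual.O5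

/-- **S-O5-1 (conjecture; Jetchev Cor. 1.5 without `p ∤ N`, Tamagawa prime `q ≠ p`)** for ONE curve `W` at ONE odd
prime `p`: for every level `N`, every Heegner field `K` (`d_K ≠ -3`), every Heegner point `P` of infinite order
coming from a parametrisation of `W` at level `N` with `W` optimal (`_hopt`, as in the tree fact), `ρ̄_{W,p}` onto,
and every prime `q ∣ N`, `q ≠ p`:  `ord_p #Ш(W/K)[p^∞] + 2·ord_p c_q ≤ 2·ord_p [W(K) : ℤ P]`.
EVIDENCE: [Jetchev2008, Cor. 1.5 (p. 3)] proves it under `p ∤ N`; see the module docstring for why no step of the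
printed proof is seen to use `p ∤ N` beyond Rem. 1.2. -/
@[conjecture] def JetchevBoundFor (W : WeierstrassCurve ℚ) [W.IsElliptic] (p : ℕ) [Fact p.Prime] : Prop :=
  ∀ (N : ℕ) [NeZero N] (K : Type) [Field K] [NumberField K]
    (_hK : IsImaginaryQuadratic K) (_hD3 : NumberField.discr K ≠ -3)
    (_hH : SatisfiesHeegnerHypothesis N K)
    (_hopt : ∃ Dt : ModularParametrizationData W N,
      ∀ z ∈ Dt.L.lattice, ∃ w ∈ periodLattice Dt.f, z = (Dt.c : ℂ) * w)
    {P : (W.baseChange K).toAffine.Point} (_hP : IsHeegnerPoint N W K P) (_hnt : ¬ IsOfFinAddOrder P)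
    (_hp2 : p ≠ 2) (_hρ : W.HasSurjectiveModNGaloisRep p)
    (q : ℕ) [Fact q.Prime] (_hqN : q ∣ N) (_hqp : q ≠ p),
    padicValNat p (Nat.card (AddCommGroup.primaryComponent (W.baseChange K).sha p)) +
        2 * padicValNat p ((W.baseChange ℚ_[q]).localTamagawaNumber ℤ_[q]) ≤
      2 * padicValNat p (AddSubgroup.zmultiples P).index

/-- **S-O5-1 on the census cell O5** (tame potentially good additive reduction at `3`): `Addv W 3`, `v₃(j) ≥ 0`
⇒ `JetchevBoundFor W 3`. -/
@[conjecture] def O5JetchevThree : Prop :=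
  ∀ (W : WeierstrassCurve ℚ) [W.IsElliptic] [W.IsGloballyMinimal],
    Addv W 3 → 0 ≤ padicValRat 3 W.j → JetchevBoundFor W 3

/-- Faithfulness / content check: for a curve `W` none of whose modular parametrisation levels is divisible by
`p` (i.e. `p ∤ N_W`), the conjecture IS Jetchev's printed Cor. 1.5 (tree Literature fact, consumed as a hypothesis);
so `JetchevBoundFor W p` has new content exactly when `p` divides the conductor — the O5 case `p = 3`, `9 ∣ N`. -/
theorem jetchevBoundFor_of_cor15_of_not_dvd_level
    (hJ : Jetchev2008.cor15_padicValNat_card_primaryComponent_sha_le)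
    (W : WeierstrassCurve ℚ) [W.IsElliptic] (p : ℕ) [Fact p.Prime]
    (hN : ∀ (N : ℕ) [NeZero N], Nonempty (ModularParametrizationData W N) → ¬ p ∣ N) :
    JetchevBoundFor W p := by
  intro N _ K _ _ hK hD3 hH hopt P hP hnt hp2 hρ q _ hqN _hqp
  obtain ⟨Dt, hDt⟩ := hopt
  exact hJ N W K hK hD3 hH ⟨Dt, hDt⟩ hP hnt p hp2 (hN N ⟨Dt⟩) hρ q hqN

/-! ## S-O5-2 — the INEQUALITY (Kolyvagin) direction of `HeegnerIndexBSDAt`, sharpened by the FULL Tamagawa product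

Jetchev's Conjecture 1.3 [Jetchev2008, p. 3: "If p satisfies Hypothesis (∗) then m_∞ = ord_p(∏_{q∣N} c_q)"] in its
`≥` direction, combined with Kolyvagin's formula (1), reads `#Ш(E/K)[p^∞] ≤ p^{2 m₀ − 2·ord_p ∏ c_q}`; his Thm. 1.4 /
Cor. 1.5 prove the `max` version. Below: that inequality at an arbitrary odd surjective `p` in the census currency of
`HeegnerIndexBSDAt` (same binders, `=` replaced by `≤`, Manin term kept). WHY IT MATTERS (C4, o5-r2 GEN 2): on every
Heegner pair with `a = b = 0` (both analytic Ш's prime to `p`) the Gross–Zagier identity in census currency gives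
`k = t + m`, so THIS inequality alone forces `Ш(E/K)[p] = 0`, i.e. BSD_p for BOTH members — exactness is not needed;
the C4 census finds such a partner for > 90 % of the O5 r_an = 1 residual rows (numbers in cells/o5o6/TARGETS.md §O5). -/

/-- **S-O5-2 (conjecture; Kolyvagin direction of Gross's Conj. 1.2 with the full Tamagawa product = Jetchev Conj. 1.3
`≥` + Kolyvagin's formula, census currency)**: same binders as `HeegnerIndexBSDAt W p`, conclusion
`ord_p #Ш(E/K)[p^∞] + 2·ord_p ∏_q c_q + 2·ord_p c_D ≤ 2·ord_p [E(K) : ℤ P]`.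
EVIDENCE: [Jetchev2008, Conj. 1.3, Thm. 1.4, Cor. 1.5 (p. 3)] (the `max_q` version is a theorem under `p ∤ N`). -/
@[conjecture] def HeegnerIndexUpperAt (W : WeierstrassCurve ℚ) [W.IsElliptic] [W.IsGloballyMinimal]
    (p : ℕ) [Fact p.Prime] : Prop :=
  p ≠ 2 → W.HasSurjectiveModNGaloisRep p →
  ∀ {N : ℕ} [NeZero N] (D : ModularParametrizationData W N)
    (K : Type) [Field K] [NumberField K], IsImaginaryQuadratic K → SatisfiesHeegnerHypothesis N K →
    NumberField.discr K < -4 →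
  ∀ (H : HeegnerDatum N (NumberField.discr K)) (ι : K →+* ℂ) (P : (W.baseChange K).toAffine.Point),
    WeierstrassCurve.Affine.Point.map ι.toRatAlgHom P = heegnerPointComplex D H →
    ¬ IsOfFinAddOrder P →
    padicValNat p (Nat.card (AddCommGroup.primaryComponent (W.baseChange K).sha p)) +
        2 * padicValNat p W.tamagawaProduct + 2 * padicValInt p D.maninConstant ≤
      2 * padicValNat p (AddSubgroup.zmultiples P).index

/-- **S-O5-2 on the census cell O5 at `p = 3`.** -/
@[conjecture] def O5HeegnerIndexUpperThree : Prop :=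
  ∀ (W : WeierstrassCurve ℚ) [W.IsElliptic] [W.IsGloballyMinimal],
    Addv W 3 → 0 ≤ padicValRat 3 W.j → HeegnerIndexUpperAt W 3

/-- T-O5-B ⇒ S-O5-2 per curve and prime (exactness implies the Kolyvagin direction). -/
theorem heegnerIndexUpperAt_of_heegnerIndexBSDAt (W : WeierstrassCurve ℚ) [W.IsElliptic] [W.IsGloballyMinimal]
    (p : ℕ) [Fact p.Prime] (h : HeegnerIndexBSDAt W p) : HeegnerIndexUpperAt W p := by
  intro hp2 hρ N _ D K _ _ hK hH hdisc H ι P hP hnt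
  exact le_of_eq (h hp2 hρ D K hK hH hdisc H ι P hP hnt)

/-- `O5HeegnerIndexThree` (T-O5-B, tree) ⇒ `O5HeegnerIndexUpperThree` (S-O5-2); note T-O5-B also asks `f₃ = 2` and tower
surjectivity, so the implication is stated from the tower-free sibling `HeegnerIndexThree` restricted to O5… — here we
record the clean per-curve form: exactness at `(W, 3)` gives the inequality at `(W, 3)`. -/
theorem o5HeegnerIndexUpperThree_of_forall (h : ∀ (W : WeierstrassCurve ℚ) [W.IsElliptic] [W.IsGloballyMinimal],
      Addv W 3 → 0 ≤ padicValRat 3 W.j → HeegnerIndexBSDAt W 3) : O5HeegnerIndexUpperThree := by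
  intro W _ _ hadd hj
  exact heegnerIndexUpperAt_of_heegnerIndexBSDAt W 3 (h W hadd hj)

end Summit.BirchSwinnertonDyer.Rank1Residual.O5

end
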